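import Summits.ABC.ABC.Theses.IUTThetaPilot
import Literature.IUT.LogVolume.Corollary22PartII
import Literature.IUT.LogVolume.Corollary22GaloisImage
import Literature.IUT.LogVolume.Corollary22PartIILemmas
import Literature.IUT.LogVolume.Corollary22ThetaFieldExists
import Literature.IUT.LogVolume.Corollary22CondP6Five
import Literature.IUT.LogVolume.Corollary22Thm110Reduction
import Literature.IUT.LogVolume.GenuineLogTheta
import Literature.IUT.LogVolume.Theorem110
import HarnessLib

/-!
# Route `route-ABC-IUTThetaPilot`, crux `ThetaPartII` (stmt-ABC-19678): the crux REDUCED IN THE TREE to one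
# printed-currency inequality per admissible `(λ, l)` — [IUTchIV] Thm. 1.10 Step (viii) at a point of the `λ`-line

Mochizuki, *Inter-universal Teichmüller theory IV*, RIMS manuscript (Apr. 2020; = PRIMS **57** (2021)), Thm. 1.10
(pp. 22–31), Cor. 2.2 (ii) (pp. 43–48; Thm. 1.10 is applied on p. 46 l. 1). PROOF-ONLY helper on the crux item (does
not close it); companion of the registered layer-2 skeleton `Summit.ABC.ABC.Cruxes.ThetaPartII.Display` (abc-iut-S-d2 g3 /
abc-iut-c312-8 g3), whose composition it places in the tree WITHOUT importing the (re-based) datum vocabulary. TAKES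
NO SIDE on [IUTchIII] Cor. 3.12: it enters only inside the HYPOTHESIS "squeeze", never asserted.

Notation for `P = (F_tpd, λ) ∈ U_X` presented minimally and a prime `l` (abc-iut-S-d2's `Cor22.*` vocabulary):
`log(q) := Cor22.logQAvoid P {2,l}`, `L := log-diff(λ) + Cor22.logCondAvoid P {2,l}`, `d := d_mod`, `d* := 2^{12}·3^3·5·d`.
Two constants are treated:
* `B(P,l) := (l+1)/4·{(1+4/l)·(L + log(2^{11}·3^3·5^2) + 2·log l) + (4/l)·(2d·L + log(2·3·5·l)) + (20/3)·log(d*·l)·π(d*·l)}`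
  — Step (v)'s sum (p. 29) with print's SHARP Step (ii)/(iii) intermediate bounds (pp. 24, 26) substituted; this is the
  constant of the registered stub `stub_hullVolume` (`display_of_squeeze`, via abc-iut-S3's `Thm110Numerics.theorem110`);
* `B_III(P,l) := (l+1)/4·{(1 + 12·d/l)·L + 2·log l + 52 + (20/3)·log(d*·l)·π(d*·l)}` — Step (v)'s sum with print's
  Step (iii) FINAL display (p. 26) substituted; it keeps print's own roundings (`log(2^11·3^3·5^2) ≤ 21`, `log(30·l) ≤ 5
  + log l`) and so also absorbs the tame ramification of `K/F` at bad places above `2`, which the Step (ii) display as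
  printed omits (cell finding F-Sd2g3-1) (`display_of_squeezeIII`, Step (viii) redone without `ProofData`).
The **squeeze at `(P,l)`** with constant `C` is `((l+1)/24 − 1/(2l))·log(q) ≤ C + ((l+5)/4)·log π` — what
[IUTchIII] Cor. 3.12 (`−|log(q)| ≤ −|log(Θ)|`, `|log(q)| = (1/2l)·log(q)`, p. 23) gives together with the hull estimate
of Steps (ii)–(vii) (`((l+5)/4)·log π` = Step (vii) = `ThetaVolumeInput.archLogTheta l`); at abc-iut-S2's genuine Θ-volume
data it is `PointDict.logQAvoid_le_of_cor312AtDatum` applied to the stubs `stub_cor312`, `stub_hullVolume`.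
Results (namespace `Summit.ABC.ABC.Theorems.ThetaPartIIDisplay`): `display_of_squeeze`, `display_of_squeezeIII` (squeeze,
`l ≥ 5` prime, `l ≠ 5`, `IsEtaPrm η` ⟹ `Cor22.Display P l η`); `thm110Legendre_of_squeeze(III)` (squeeze at every
admissible `(P,l)`, binders EXACTLY those of `Cor22.Thm110Legendre`, ⟹ `Thm110Legendre`; `l ≠ 5` by abc-iut-S-d1's
`Cor22.exists_isThetaField` + `Cor22.not_condP6_five_of_isThetaField`); `ThetaPartII_of_squeeze(III)` (⟹ the crux BY
NAME via abc-iut-S3's `Cor22.exists_partII_of_thm110Legendre` + the proved `Cor22.fullGaloisImage_holds`; CONDITIONAL,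
`proof.conditional`). [cite: Mochizuki2012, IUTchIV Thm. 1.10 pp. 22–31; Cor. 2.2 (ii) pp. 41–48]
[claim: Mochizuki2012, status: disputed] for every IUT sentence quoted. HONEST FRAMING: nothing here asserts abc, Thm. 1.10
or Cor. 3.12.
-/

set_option linter.dupNamespace false

noncomputable section

namespace Summit.ABC.ABC.Theorems.ThetaPartIIDisplay

open Literature.IUT.LogVolume Literature.NumberTheory.DiophantineGeometry.GenEll

/-! ## Step (viii) at a point with the constant `B_III` (print's Step (iii) final display) -/

/-- **Step (viii) at a point, constant `B_III`** (print's Step (iii) FINAL display p. 26 substituted into Step (v)'s sum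
p. 29; `𝔰^≤` p. 25; `e_mod ≤ d_mod` p. 22): the squeeze with `B_III(P,l)`, `l ≥ 5` prime, `l ≠ 5`, `IsEtaPrm η_prm` ⟹
`Cor22.Display P l η_prm`. Proof = print's Step (viii) (pp. 30–31) at the numerics of the point WITHOUT `ProofData`:
`(l+5)/4·log π ≤ (l+1)/4·4` (Step (vii)), `(l+1)/4·(1/6)·(12/l²) ≥ 1/(2l)`, Prop. 1.6 `log(d*·l)·π(d*·l) ≤ (4/3)·(d*·l +
η_prm)` (`log_mul_primeCounting_le_of_isEtaPrm`, PROVED), the absorption `2·log l + 56 ≤ (1/3)·(4/3)·(d*·l + η_prm)`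
(`Thm110Numerics.stepviii_absorb`), whence the braces of `C_Θ` are `≥ 0`, `C_Θ ≥ −1`, and the last paragraph
(`Thm110Numerics.display_of_neg_one_le_CTheta`, `l ≥ 7`). Pure arithmetic; no side taken. [claim: Mochizuki2012, status: disputed] -/
theorem display_of_squeezeIII {P : NFPoint} {l : ℕ} (hl : l.Prime) (h5 : 5 ≤ l) (hne : l ≠ 5) {η : ℝ}
    (hη : IsEtaPrm η)
    (hineq : (((l : ℝ) + 1) / 24 - 1 / (2 * l)) * Cor22.logQAvoid P {2, l} ≤
      ((l : ℝ) + 1) / 4 *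
          ((1 + 12 * (Cor22.dmod P : ℝ) / l) * (P.logDiff + Cor22.logCondAvoid P {2, l})
            + 2 * Real.log l + 52
            + 20 / 3 * Real.log (((2 ^ 12 * 3 ^ 3 * 5 * Cor22.dmod P : ℕ) : ℝ) * (l : ℝ))
              * (Nat.primeCounting (2 ^ 12 * 3 ^ 3 * 5 * Cor22.dmod P * l) : ℝ))
        + ThetaVolumeInput.archLogTheta l) :
    Cor22.Display P l η := by
  have hLD : 0 ≤ P.logDiff := P.logDiff_nonneg
  have hLC : 0 ≤ Cor22.logCondAvoid P {2, l} := Cor22.logCondAvoid_nonneg P {2, l}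
  have hl1 : (1 : ℝ) ≤ l := by exact_mod_cast hl.one_lt.le
  have hl0 : (0 : ℝ) < l := by linarith
  have hd1 : (1 : ℝ) ≤ (Cor22.dmod P : ℝ) := by exact_mod_cast Cor22.dmod_pos P
  have hη0 : 0 < η := hη.1
  by_cases hq : 0 < Cor22.logQAvoid P {2, l}
  swap
  · -- `log(q) ≤ 0`: the display is trivial (its right-hand side is nonnegative)
    have hq' : Cor22.logQAvoid P {2, l} ≤ 0 := not_lt.1 hq
    unfold Cor22.Display
    have h1 : 0 ≤ (1 + 20 * (Cor22.dmod P : ℝ) / l) * (P.logDiff + Cor22.logCondAvoid P {2, l}) := by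
      positivity
    have h2 : 0 ≤ 20 * (2 ^ 12 * 3 ^ 3 * 5 * (Cor22.dmod P : ℝ) * l + η) := by positivity
    linarith
  -- the numerics of the point, with `−|log(Θ)| := −|log(q)|`
  let X : Thm110Numerics :=
    { l := l, prime_l := hl, five_le_l := h5
      dmod := Cor22.dmod P, one_le_dmod := Cor22.dmod_pos P
      emod := Cor22.dmod P, one_le_emod := Cor22.dmod_pos P, emod_le_dmod := le_rfl
      etaPrm := η, etaPrm_pos := hη.1
      logDiffTpd := P.logDiff, logDiffTpd_nonneg := hLD
      logCondTpd := Cor22.logCondAvoid P {2, l}, logCondTpd_nonneg := hLC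
      logDiffF := P.logDiff, logDiffF_nonneg := hLD
      logCondF := Cor22.logCondAvoid P {2, l}, logCondF_nonneg := hLC
      logq := Cor22.logQAvoid P {2, l}, logq_pos := hq
      negLogTheta := -(Cor22.logQAvoid P {2, l} / (2 * (l : ℝ))) }
  have h7 : 7 ≤ X.l := X.seven_le_l_of_ne_five hne
  -- Prop. 1.6 (the prime number theorem, proved in the tree): `log(d*·l)·π(d*·l) ≤ (4/3)·(d*·l + η)`
  have hpnt : Real.log (((2 ^ 12 * 3 ^ 3 * 5 * Cor22.dmod P : ℕ) : ℝ) * (l : ℝ))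
      * (Nat.primeCounting (2 ^ 12 * 3 ^ 3 * 5 * Cor22.dmod P * l) : ℝ) ≤
      4 / 3 * ((((2 ^ 12 * 3 ^ 3 * 5 * Cor22.dmod P : ℕ) : ℝ)) * l + η) := by
    have h0 : (0 : ℝ) ≤ (((2 ^ 12 * 3 ^ 3 * 5 * Cor22.dmod P : ℕ) : ℝ)) * l := by positivity
    have h2 := log_mul_primeCounting_le_of_isEtaPrm hη h0
    rwa [show ⌊(((2 ^ 12 * 3 ^ 3 * 5 * Cor22.dmod P : ℕ) : ℝ)) * (l : ℝ)⌋₊ =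
        2 ^ 12 * 3 ^ 3 * 5 * Cor22.dmod P * l by
      exact_mod_cast Nat.floor_natCast (2 ^ 12 * 3 ^ 3 * 5 * Cor22.dmod P * l)] at h2
  -- Step (viii): `2·log l + 56 ≤ (1/3)·(4/3)·(d*·l + η)` (abc-iut-S3's `stepviii_absorb`)
  have habs : 2 * Real.log (l : ℝ) + 56 ≤
      1 / 3 * (4 / 3) * ((((2 ^ 12 * 3 ^ 3 * 5 * Cor22.dmod P : ℕ) : ℝ)) * l + η) :=
    Thm110Numerics.stepviii_absorb X
  -- Step (vii): `(l+5)/4·log π ≤ (l+1)/4·4`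
  have harch : ThetaVolumeInput.archLogTheta l ≤ ((l : ℝ) + 1) / 4 * 4 := by
    unfold ThetaVolumeInput.archLogTheta
    have hpi := log_pi_le_two
    have hl5 : (5 : ℝ) ≤ l := by exact_mod_cast h5
    have h1 : ((l : ℝ) + 5) / 4 * Real.log Real.pi ≤ ((l : ℝ) + 5) / 4 * 2 :=
      mul_le_mul_of_nonneg_left hpi (by positivity)
    linarith
  -- the braces of `C_Θ` are nonnegative
  have hbr : 0 ≤ X.bracket := by
    show 0 ≤ (1 + 12 * (Cor22.dmod P : ℝ) / l) * (P.logDiff + Cor22.logCondAvoid P {2, l})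
      + 10 * ((((2 ^ 12 * 3 ^ 3 * 5 * Cor22.dmod P : ℕ) : ℝ)) * l + η)
      - 1 / 6 * (1 - 12 / ((l : ℝ) ^ 2)) * Cor22.logQAvoid P {2, l}
    have hc : (0 : ℝ) < ((l : ℝ) + 1) / 4 := by positivity
    -- hypothesis + Step (vii)
    have h1 : (((l : ℝ) + 1) / 24 - 1 / (2 * l)) * Cor22.logQAvoid P {2, l} ≤
        ((l : ℝ) + 1) / 4 *
          ((1 + 12 * (Cor22.dmod P : ℝ) / l) * (P.logDiff + Cor22.logCondAvoid P {2, l})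
            + 2 * Real.log l + 52
            + 20 / 3 * Real.log (((2 ^ 12 * 3 ^ 3 * 5 * Cor22.dmod P : ℕ) : ℝ) * (l : ℝ))
              * (Nat.primeCounting (2 ^ 12 * 3 ^ 3 * 5 * Cor22.dmod P * l) : ℝ) + 4) := by
      have e : ((l : ℝ) + 1) / 4 *
          ((1 + 12 * (Cor22.dmod P : ℝ) / l) * (P.logDiff + Cor22.logCondAvoid P {2, l})
            + 2 * Real.log l + 52
            + 20 / 3 * Real.log (((2 ^ 12 * 3 ^ 3 * 5 * Cor22.dmod P : ℕ) : ℝ) * (l : ℝ))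
              * (Nat.primeCounting (2 ^ 12 * 3 ^ 3 * 5 * Cor22.dmod P * l) : ℝ) + 4) =
          ((l : ℝ) + 1) / 4 *
          ((1 + 12 * (Cor22.dmod P : ℝ) / l) * (P.logDiff + Cor22.logCondAvoid P {2, l})
            + 2 * Real.log l + 52
            + 20 / 3 * Real.log (((2 ^ 12 * 3 ^ 3 * 5 * Cor22.dmod P : ℕ) : ℝ) * (l : ℝ))
              * (Nat.primeCounting (2 ^ 12 * 3 ^ 3 * 5 * Cor22.dmod P * l) : ℝ))
          + ((l : ℝ) + 1) / 4 * 4 := by ring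
      rw [e]
      linarith
    -- `(l+1)/4·(1/6)·(1 − 12/l²) ≤ (l+1)/24 − 1/(2l)`
    have hcoef : ((l : ℝ) + 1) / 4 * (1 / 6 * (1 - 12 / ((l : ℝ) ^ 2))) ≤
        ((l : ℝ) + 1) / 24 - 1 / (2 * l) := by
      have hdiff : ((l : ℝ) + 1) / 24 - 1 / (2 * l) - ((l : ℝ) + 1) / 4 * (1 / 6 * (1 - 12 / ((l : ℝ) ^ 2)))
          = 1 / (2 * (l : ℝ) ^ 2) := by
        field_simp
        ring
      have hpos : (0 : ℝ) ≤ 1 / (2 * (l : ℝ) ^ 2) := by positivity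
      linarith
    have h2 : ((l : ℝ) + 1) / 4 * (1 / 6 * (1 - 12 / ((l : ℝ) ^ 2)) * Cor22.logQAvoid P {2, l}) ≤
        (((l : ℝ) + 1) / 24 - 1 / (2 * l)) * Cor22.logQAvoid P {2, l} := by
      calc ((l : ℝ) + 1) / 4 * (1 / 6 * (1 - 12 / ((l : ℝ) ^ 2)) * Cor22.logQAvoid P {2, l})
          = ((l : ℝ) + 1) / 4 * (1 / 6 * (1 - 12 / ((l : ℝ) ^ 2))) * Cor22.logQAvoid P {2, l} := by ring
        _ ≤ (((l : ℝ) + 1) / 24 - 1 / (2 * l)) * Cor22.logQAvoid P {2, l} :=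
          mul_le_mul_of_nonneg_right hcoef hq.le
    have h3 : 1 / 6 * (1 - 12 / ((l : ℝ) ^ 2)) * Cor22.logQAvoid P {2, l} ≤
        (1 + 12 * (Cor22.dmod P : ℝ) / l) * (P.logDiff + Cor22.logCondAvoid P {2, l})
          + 2 * Real.log l + 52
          + 20 / 3 * Real.log (((2 ^ 12 * 3 ^ 3 * 5 * Cor22.dmod P : ℕ) : ℝ) * (l : ℝ))
            * (Nat.primeCounting (2 ^ 12 * 3 ^ 3 * 5 * Cor22.dmod P * l) : ℝ) + 4 :=
      le_of_mul_le_mul_left (le_trans h2 h1) hc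
    have hE : (0 : ℝ) ≤ (((2 ^ 12 * 3 ^ 3 * 5 * Cor22.dmod P : ℕ) : ℝ)) * l + η := by positivity
    have hpnt' : 20 / 3 * Real.log (((2 ^ 12 * 3 ^ 3 * 5 * Cor22.dmod P : ℕ) : ℝ) * (l : ℝ))
        * (Nat.primeCounting (2 ^ 12 * 3 ^ 3 * 5 * Cor22.dmod P * l) : ℝ) ≤
        20 / 3 * (4 / 3 * ((((2 ^ 12 * 3 ^ 3 * 5 * Cor22.dmod P : ℕ) : ℝ)) * l + η)) := by
      rw [mul_assoc]
      exact mul_le_mul_of_nonneg_left hpnt (by norm_num)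
    -- name the (nonlinear) atoms so that the final step is visibly linear
    set W : ℝ := 20 / 3 * Real.log (((2 ^ 12 * 3 ^ 3 * 5 * Cor22.dmod P : ℕ) : ℝ) * (l : ℝ))
        * (Nat.primeCounting (2 ^ 12 * 3 ^ 3 * 5 * Cor22.dmod P * l) : ℝ) with hW
    set E : ℝ := (((2 ^ 12 * 3 ^ 3 * 5 * Cor22.dmod P : ℕ) : ℝ)) * l + η with hEdef
    set A : ℝ := (1 + 12 * (Cor22.dmod P : ℝ) / l) * (P.logDiff + Cor22.logCondAvoid P {2, l}) with hA
    set Q : ℝ := 1 / 6 * (1 - 12 / ((l : ℝ) ^ 2)) * Cor22.logQAvoid P {2, l} with hQ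
    set G : ℝ := Real.log (l : ℝ) with hG
    linarith [hpnt', habs, h3, hE]
  -- `C_Θ ≥ −1`
  have hC : -1 ≤ X.CTheta := by
    unfold Thm110Numerics.CTheta
    have hq' := X.absLogq_pos
    have hl5 := X.five_le_l_real
    have : 0 ≤ ((X.l : ℝ) + 1) / (4 * X.absLogq) * X.bracket := mul_nonneg (by positivity) hbr
    linarith
  exact Cor22.display_of_numerics X rfl rfl rfl rfl rfl rfl (Thm110Numerics.display_of_neg_one_le_CTheta h7 hC)

/-! ## The registered constant `B` (print's sharp Step (ii)/(iii) intermediates): `B ≤ B_III` -/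

/-- **Print's own roundings: `B(P,l) ≤ B_III(P,l)`** — Step (ii) final display "(1+4/l)·log(𝔡^K) ≤ (1+4/l)·(…) + 2·log(l) +
46" (p. 24: `log(2^11·3^3·5^2) ≤ 21`, `log(l)/l ≤ 1/2`, `1 + 4/l ≤ 2`) and Step (iii) final display (p. 26: `log(2·3·5·l) ≤
5 + log l`, `20/l ≤ 4`, `4/l ≤ 4·d_mod/l`) combine the sharp intermediates into `(1 + 12·d_mod/l)·L + 2·log l + 52`.
Pure arithmetic. [claim: Mochizuki2012, status: disputed] -/
theorem sharpBound_le_boundIII (P : NFPoint) {l : ℕ} (h5 : 5 ≤ l) :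
    ((l : ℝ) + 1) / 4 *
          ((1 + 4 / (l : ℝ)) * (P.logDiff + Cor22.logCondAvoid P {2, l}
              + Real.log (2 ^ 11 * 3 ^ 3 * 5 ^ 2) + 2 * Real.log l)
            + 4 / (l : ℝ) * (2 * (Cor22.dmod P : ℝ) * (P.logDiff + Cor22.logCondAvoid P {2, l})
              + Real.log (2 * 3 * 5 * (l : ℝ)))
            + 20 / 3 * Real.log (((2 ^ 12 * 3 ^ 3 * 5 * Cor22.dmod P : ℕ) : ℝ) * (l : ℝ))
              * (Nat.primeCounting (2 ^ 12 * 3 ^ 3 * 5 * Cor22.dmod P * l) : ℝ)) ≤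
      ((l : ℝ) + 1) / 4 *
          ((1 + 12 * (Cor22.dmod P : ℝ) / l) * (P.logDiff + Cor22.logCondAvoid P {2, l})
            + 2 * Real.log l + 52
            + 20 / 3 * Real.log (((2 ^ 12 * 3 ^ 3 * 5 * Cor22.dmod P : ℕ) : ℝ) * (l : ℝ))
              * (Nat.primeCounting (2 ^ 12 * 3 ^ 3 * 5 * Cor22.dmod P * l) : ℝ)) := by
  have hl5 : (5 : ℝ) ≤ l := by exact_mod_cast h5
  have hl0 : (0 : ℝ) < l := by linarith
  have hd1 : (1 : ℝ) ≤ (Cor22.dmod P : ℝ) := by exact_mod_cast Cor22.dmod_pos P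
  have hL : 0 ≤ P.logDiff + Cor22.logCondAvoid P {2, l} :=
    add_nonneg P.logDiff_nonneg (Cor22.logCondAvoid_nonneg P {2, l})
  have hc1 := log_two_pow_eleven_mul_le
  have hc1' : 0 ≤ Real.log (2 ^ 11 * 3 ^ 3 * 5 ^ 2 : ℝ) := Real.log_nonneg (by norm_num)
  have h30 := log_thirty_mul_le hl0
  have hG0 : 0 ≤ Real.log (l : ℝ) := Real.log_nonneg (by linarith)
  have hGl : Real.log (l : ℝ) / l ≤ 1 / 2 := log_div_self_le_half hl0
  have hc : (0 : ℝ) ≤ ((l : ℝ) + 1) / 4 := by positivity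
  apply mul_le_mul_of_nonneg_left _ hc
  set L := P.logDiff + Cor22.logCondAvoid P {2, l} with hLdef
  set G := Real.log (l : ℝ) with hGdef
  set c₁ := Real.log (2 ^ 11 * 3 ^ 3 * 5 ^ 2 : ℝ) with hc₁
  set c₃₀ := Real.log (2 * 3 * 5 * (l : ℝ)) with hc₃₀
  set d := (Cor22.dmod P : ℝ) with hddef
  set t : ℝ := 4 / (l : ℝ) with ht
  have ht0 : 0 ≤ t := by positivity
  have ht1 : t ≤ 4 / 5 := by rw [ht]; exact div_le_div_of_nonneg_left (by norm_num) (by norm_num) hl5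
  -- `(1 + 4/l)·L + (8d/l)·L ≤ (1 + 12d/l)·L`
  have h1 : (1 + t) * L + t * (2 * d * L) ≤ (1 + 12 * d / l) * L := by
    have e : (1 + 12 * d / (l : ℝ)) * L - ((1 + t) * L + t * (2 * d * L)) = t * (d - 1) * L := by
      rw [ht]; ring
    nlinarith [mul_nonneg (mul_nonneg ht0 (by linarith : (0 : ℝ) ≤ d - 1)) hL]
  -- the constants: `(1+t)·(c₁ + 2G) + t·c₃₀ ≤ 2G + 52`
  have h2 : t * c₁ ≤ 4 / 5 * 21 := mul_le_mul ht1 hc1 hc1' (by norm_num)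
  have h3 : t * (2 * G) ≤ 4 := by
    have e3 : t * (2 * G) = 8 * (G / l) := by rw [ht]; ring
    rw [e3]; linarith
  have h4 : t * c₃₀ ≤ 6 := by
    have h4a : t * c₃₀ ≤ t * (5 + G) := mul_le_mul_of_nonneg_left h30 ht0
    have h4b : t * 5 ≤ 4 := by
      rw [ht, div_mul_eq_mul_div, div_le_iff₀ hl0]; linarith
    have h4c : t * G ≤ 2 := by linarith [h3]
    linarith
  have expand : (1 + t) * (L + c₁ + 2 * G) + t * (2 * d * L + c₃₀) =
      ((1 + t) * L + t * (2 * d * L)) + (c₁ + 2 * G) + (t * c₁ + t * (2 * G) + t * c₃₀) := by ring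
  rw [expand]
  linarith

/-- **Step (viii) of [IUTchIV] Thm. 1.10 at a point of the `λ`-line, registered constant `B`** (pp. 30–31 + last
paragraph of the proof): the squeeze with `B(P,l)`, `l ≥ 5` prime, `l ≠ 5`, `IsEtaPrm η_prm` ⟹ `Cor22.Display P l η_prm` —
by `B ≤ B_III` (`sharpBound_le_boundIII`) and `display_of_squeezeIII`. [claim: Mochizuki2012, status: disputed] -/
theorem display_of_squeeze {P : NFPoint} {l : ℕ} (hl : l.Prime) (h5 : 5 ≤ l) (hne : l ≠ 5) {η : ℝ}
    (hη : IsEtaPrm η)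
    (hineq : (((l : ℝ) + 1) / 24 - 1 / (2 * l)) * Cor22.logQAvoid P {2, l} ≤
      ((l : ℝ) + 1) / 4 *
          ((1 + 4 / (l : ℝ)) * (P.logDiff + Cor22.logCondAvoid P {2, l}
              + Real.log (2 ^ 11 * 3 ^ 3 * 5 ^ 2) + 2 * Real.log l)
            + 4 / (l : ℝ) * (2 * (Cor22.dmod P : ℝ) * (P.logDiff + Cor22.logCondAvoid P {2, l})
              + Real.log (2 * 3 * 5 * (l : ℝ)))
            + 20 / 3 * Real.log (((2 ^ 12 * 3 ^ 3 * 5 * Cor22.dmod P : ℕ) : ℝ) * (l : ℝ))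
              * (Nat.primeCounting (2 ^ 12 * 3 ^ 3 * 5 * Cor22.dmod P * l) : ℝ))
        + ThetaVolumeInput.archLogTheta l) :
    Cor22.Display P l η :=
  display_of_squeezeIII hl h5 hne hη (le_trans hineq (add_le_add (sharpBound_le_boundIII P h5) le_rfl))

/-! ## From the point to `Thm110Legendre` and to the crux -/

/-- **`Cor22.Thm110Legendre` from a pointwise display at `l ≠ 5`** ([IUTchIV] Cor. 2.2 (ii) proof p. 46 l. 1):
the binders are EXACTLY those of `Cor22.Thm110Legendre`; the extra `l ≠ 5` (Thm. 1.10 p. 22) is discharged because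
the `5`-torsion of `E_F` is rational over a theta field of `λ`, which exists (abc-iut-S-d1's `Cor22.exists_isThetaField`),
so (P6) fails at `5` (`Cor22.not_condP6_five_of_isThetaField`). [claim: Mochizuki2012, status: disputed] -/
theorem thm110Legendre_of_pointwise
    (hpt : ∀ η : ℝ, IsEtaPrm η → ∀ P : NFPoint, P ∈ UP → ∀ l : ℕ, l.Prime → 5 ≤ l → l ≠ 5 →
      Cor22.AdmitsCore P → Cor22.CondP2 P l → Cor22.CondP5 P l → Cor22.CondP6 P l → Cor22.Display P l η) :
    Cor22.Thm110Legendre := by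
  intro η hη P hP l hl h5 hcore hP2 hP5 hP6
  have hU : P.InU := (show P.InU ∧ P.IsMinimal from hP).1
  have hne : l ≠ 5 := by
    rintro rfl
    obtain ⟨F, hNF, hF⟩ := Cor22.exists_isThetaField P hU
    haveI := hNF
    exact Cor22.not_condP6_five_of_isThetaField hU F hF hP6
  exact hpt η hη P hP l hl h5 hne hcore hP2 hP5 hP6

/-- **`Cor22.Thm110Legendre` from the squeeze (registered constant `B`) at every admissible point** — CONDITIONAL on
`hsq` (where [IUTchIII] Cor. 3.12 and the log-volume computations enter). [claim: Mochizuki2012, status: disputed] -/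
theorem thm110Legendre_of_squeeze
    (hsq : ∀ P : NFPoint, P ∈ UP → ∀ l : ℕ, l.Prime → 5 ≤ l →
      Cor22.AdmitsCore P → Cor22.CondP2 P l → Cor22.CondP5 P l → Cor22.CondP6 P l →
      (((l : ℝ) + 1) / 24 - 1 / (2 * l)) * Cor22.logQAvoid P {2, l} ≤
        ((l : ℝ) + 1) / 4 *
          ((1 + 4 / (l : ℝ)) * (P.logDiff + Cor22.logCondAvoid P {2, l}
              + Real.log (2 ^ 11 * 3 ^ 3 * 5 ^ 2) + 2 * Real.log l)
            + 4 / (l : ℝ) * (2 * (Cor22.dmod P : ℝ) * (P.logDiff + Cor22.logCondAvoid P {2, l})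
              + Real.log (2 * 3 * 5 * (l : ℝ)))
            + 20 / 3 * Real.log (((2 ^ 12 * 3 ^ 3 * 5 * Cor22.dmod P : ℕ) : ℝ) * (l : ℝ))
              * (Nat.primeCounting (2 ^ 12 * 3 ^ 3 * 5 * Cor22.dmod P * l) : ℝ))
        + ThetaVolumeInput.archLogTheta l) :
    Cor22.Thm110Legendre :=
  thm110Legendre_of_pointwise fun _ hη P hP l hl h5 hne hcore hP2 hP5 hP6 =>
    display_of_squeeze hl h5 hne hη (hsq P hP l hl h5 hcore hP2 hP5 hP6)

/-- **`Cor22.Thm110Legendre` from the squeeze with the Step (iii)-final-display constant `B_III`** at every admissible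
point — CONDITIONAL on `hsq`. [claim: Mochizuki2012, status: disputed] -/
theorem thm110Legendre_of_squeezeIII
    (hsq : ∀ P : NFPoint, P ∈ UP → ∀ l : ℕ, l.Prime → 5 ≤ l →
      Cor22.AdmitsCore P → Cor22.CondP2 P l → Cor22.CondP5 P l → Cor22.CondP6 P l →
      (((l : ℝ) + 1) / 24 - 1 / (2 * l)) * Cor22.logQAvoid P {2, l} ≤
        ((l : ℝ) + 1) / 4 *
          ((1 + 12 * (Cor22.dmod P : ℝ) / l) * (P.logDiff + Cor22.logCondAvoid P {2, l})
            + 2 * Real.log l + 52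
            + 20 / 3 * Real.log (((2 ^ 12 * 3 ^ 3 * 5 * Cor22.dmod P : ℕ) : ℝ) * (l : ℝ))
              * (Nat.primeCounting (2 ^ 12 * 3 ^ 3 * 5 * Cor22.dmod P * l) : ℝ))
        + ThetaVolumeInput.archLogTheta l) :
    Cor22.Thm110Legendre :=
  thm110Legendre_of_pointwise fun _ hη P hP l hl h5 hne hcore hP2 hP5 hP6 =>
    display_of_squeezeIII hl h5 hne hη (hsq P hP l hl h5 hcore hP2 hP5 hP6)

/-- **The crux `ThetaPartII` (stmt-ABC-19678) BY NAME from the squeeze (constant `B`) at every admissible point**: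
`thm110Legendre_of_squeeze`, then [IUTchIV] Cor. 2.2 (ii) uniform by abc-iut-S3's `Cor22.exists_partII_of_thm110Legendre`
(printed proof pp. 43–48) and the PROVED classical Galois-image input `Cor22.fullGaloisImage_holds`. So the crux is
kernel-reduced to ONE inequality in print's currency per admissible `(λ, l)` — at abc-iut-S2's genuine Θ-volume data
exactly "Cor. 3.12 at the data of `(P,l)`" ∧ "the hull estimate with the printed constant" (stubs `stub_cor312`,
`stub_hullVolume`, given `stub_thetaData`). CONDITIONAL (`proof.conditional`); the item stays open.
[claim: Mochizuki2012, status: disputed] -/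
theorem ThetaPartII_of_squeeze
    (hsq : ∀ P : NFPoint, P ∈ UP → ∀ l : ℕ, l.Prime → 5 ≤ l →
      Cor22.AdmitsCore P → Cor22.CondP2 P l → Cor22.CondP5 P l → Cor22.CondP6 P l →
      (((l : ℝ) + 1) / 24 - 1 / (2 * l)) * Cor22.logQAvoid P {2, l} ≤
        ((l : ℝ) + 1) / 4 *
          ((1 + 4 / (l : ℝ)) * (P.logDiff + Cor22.logCondAvoid P {2, l}
              + Real.log (2 ^ 11 * 3 ^ 3 * 5 ^ 2) + 2 * Real.log l)
            + 4 / (l : ℝ) * (2 * (Cor22.dmod P : ℝ) * (P.logDiff + Cor22.logCondAvoid P {2, l})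
              + Real.log (2 * 3 * 5 * (l : ℝ)))
            + 20 / 3 * Real.log (((2 ^ 12 * 3 ^ 3 * 5 * Cor22.dmod P : ℕ) : ℝ) * (l : ℝ))
              * (Nat.primeCounting (2 ^ 12 * 3 ^ 3 * 5 * Cor22.dmod P * l) : ℝ))
        + ThetaVolumeInput.archLogTheta l) :
    Summit.ABC.ABC.Theses.IUTThetaPilot.ThetaPartII := by
  unfold Summit.ABC.ABC.Theses.IUTThetaPilot.ThetaPartII
  exact Cor22.exists_partII_of_thm110Legendre (thm110Legendre_of_squeeze hsq) Cor22.fullGaloisImage_holds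

/-- **The crux `ThetaPartII` BY NAME from the squeeze with the constant `B_III`** at every admissible point
(`thm110Legendre_of_squeezeIII` + `Cor22.exists_partII_of_thm110Legendre` + `Cor22.fullGaloisImage_holds`).
CONDITIONAL; the item stays open. [claim: Mochizuki2012, status: disputed] -/
theorem ThetaPartII_of_squeezeIII
    (hsq : ∀ P : NFPoint, P ∈ UP → ∀ l : ℕ, l.Prime → 5 ≤ l →
      Cor22.AdmitsCore P → Cor22.CondP2 P l → Cor22.CondP5 P l → Cor22.CondP6 P l →
      (((l : ℝ) + 1) / 24 - 1 / (2 * l)) * Cor22.logQAvoid P {2, l} ≤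
        ((l : ℝ) + 1) / 4 *
          ((1 + 12 * (Cor22.dmod P : ℝ) / l) * (P.logDiff + Cor22.logCondAvoid P {2, l})
            + 2 * Real.log l + 52
            + 20 / 3 * Real.log (((2 ^ 12 * 3 ^ 3 * 5 * Cor22.dmod P : ℕ) : ℝ) * (l : ℝ))
              * (Nat.primeCounting (2 ^ 12 * 3 ^ 3 * 5 * Cor22.dmod P * l) : ℝ))
        + ThetaVolumeInput.archLogTheta l) :
    Summit.ABC.ABC.Theses.IUTThetaPilot.ThetaPartII := by
  unfold Summit.ABC.ABC.Theses.IUTThetaPilot.ThetaPartII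
  exact Cor22.exists_partII_of_thm110Legendre (thm110Legendre_of_squeezeIII hsq) Cor22.fullGaloisImage_holds

end Summit.ABC.ABC.Theorems.ThetaPartIIDisplay

end
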